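/-
Copyright (c) 2026 the pub-hodgecm-mathlib formalisation cell (harness21).  Prover seat hodgecm-mathlib-K2E4-p09 (g0), Track B «K2-LIT» ∕ h413, ENGINE E4 unit U6 `ArchLimitConstant`:
the PACKER of the `G′`-package (K2E4-p11's offer (i) accepted 22:32:05Z) — `hG` of the #9 assembly ★ p855083.  2026-09-03.
-/
import Summits.HodgeConjecture.HodgeConjecture.Theorems.K2E4ArchGPrimeReg        -- ★ p855267 (K2E4-p11): (reg) `gState_empty_eq_finsum` (+ ★ `K2E4ArchGPrimeDefs`: `gState`, `wallPoint`, `embCircle`)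
import Summits.HodgeConjecture.HodgeConjecture.Theorems.K2E4ArchGPrimePins       -- ★ (K2E4-p11): (pins) `exists_pinnedRefs` (the (−1)-pinned wall references)
import Summits.HodgeConjecture.HodgeConjecture.Theorems.K2E4ArchGPrimeStep       -- ★ (K2E4-p11): (step) `gState_step`
import Summits.HodgeConjecture.HodgeConjecture.Theorems.K2E4ArchGPrimeEnd        -- ★ p855509 (K2E4-p13): (end) `exists_gState_univ_eq` = ★ (end-read) p855485 ∘ ★ (end-alg) p855388
import Literature.NumberTheory.Automorphic.ArchProductHaarReading                  -- ★ `exists_isHaarMeasure_eq_map_archPiEquivCM_symm_pi` (every Haar on `G′_∞` is a product reading)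
import Literature.NumberTheory.Rogawski1990.ArchCentralDescentAssemblyKit            -- ★ (S3) `isMulRightInvariant_of_isHaarMeasure_archLocal_diagonal` (the `U(σ_w diag α)(ℂ)` are unimodular)
import Literature.NumberTheory.Rogawski1990.ArchSmoothAmbientLift                    -- ★ (3A) `ArchSmooth.exists_contDiff` (ambient `C_c^∞` lift of a test function)
import HarnessLib

/-!
# K2 · E4 · U6 — the PACKER of the `G′`-package: `Nonempty (GPrimeData L α T′ ν e₁ e₂ h₁ h₂)` under the `hG` binders of the #9 assembly

Cell `pub/hodgecm-mathlib` (D-0151), HCML Track B, crux H413 = `stmt-HodgeConjecture-24833`; lane `--supports stmt-HodgeConjecture-24833 --as helper`.  THEOREMS ONLY.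
★ p855083 `K2E4ExplicitArchSingularTransferOfPackages.explicitArchSingularTransfer_of_packages` takes
`hG : ∀ α … T′ μω … c … ν [Haar] [right-invariant] e₁ e₂ h₁ h₂ (e₁ ≠ e₂), GPrimeData L α T′ ν e₁ e₂ h₁ h₂` (★ p855024 `…Defs.GPrimeData`: fields `lam`, `lam_ne_zero`, `family`, `reg`, `step`,
`end_eq`).  K2E4-p11 built the package over the concrete κ-weighted `G′`-state ★ `K2E4ArchGPrimeDefs.gState` (per-place Haar measures `νw`, pinned wall references `νH`, Haar scalar
`χ`, ambient lift `Θ` of the test function): (reg) ★ `K2E4ArchGPrimeReg.gState_empty_eq_finsum`, (pins) ★ `K2E4ArchGPrimePins.exists_pinnedRefs`, (step) ★ `K2E4ArchGPrimeStep.gState_step`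
(K2E4-p11, ★ tree 22:33 ∕ 22:40), (end) ★ `K2E4ArchGPrimeEnd.exists_gState_univ_eq` (K2E4-p13, p855509 = ★ (end-read) p855485 ∘ ★ (end-alg) p855388).  THIS FILE: **`gPrimeData_nonempty`** — packs them: the per-place σ-algebras are the subtype σ-algebras of
`borel (GL₃ ℂ)` and the wall-centraliser quotients carry `borel` (fixed INSIDE, as the package's convention says); `νw` := the product reading of the given Haar `ν` (★
`exists_isHaarMeasure_eq_map_archPiEquivCM_symm_pi`, so `χ = 1`), right-invariant because `U(σ_w diag α)(ℂ)` is unimodular (★ (S3)); `(νH, hνH, hpin)` := ★ (pins); `Θ_b` := the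
ambient `C_c^∞` lift of `b` (★ `ArchSmooth.exists_contDiff`, `Classical.choose`); `family b hb := gState … Θ_b`; `reg` := ★ (reg) (its `hu` and right side are the structure's, token
for token up to the reducible `embCircle`); `step` := ★ (step); `(lam, lam_ne_zero, end_eq)` := ★ (end) read through `b = Θ_b ∘ (↑↑·)`.
The assembler then takes `hG := fun α hα hαh _ _ _ _ T' μω hμu hμω c hc hT' ν _ _ e₁ e₂ h₁ h₂ hne => Classical.choice (gPrimeData_nonempty L α hα hαh T' μω hμu hμω c hc hT' ν e₁ e₂ h₁ h₂ hne)`.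
HONEST LABEL: HC_CM is proved only modulo the 7 printed citations (2 remaining named inputs: hLiu418 = `stmt-HodgeConjecture-24832`, h413 = `stmt-HodgeConjecture-24833`) until rung 0
closes; plumbing, pays no socket by itself.

## References
* [Rogawski1990] J. D. Rogawski, *Automorphic Representations of Unitary Groups in Three Variables*, Ann. of Math. Stud. 123 (1990), §8.2 Prop. 8.2.1 (a) pp. 118–119; §4.3 (4.3.1)
  p. 43; §1.7 p. 6; §14.5 Lemma 14.5.2 (b) p. 238.
* [BorelJacquet1979] A. Borel, H. Jacquet, *Automorphic forms and automorphic representations*, PSPM 33.1 (1979), §4.1.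
* [Knapp2002] A. W. Knapp, *Lie Groups Beyond an Introduction*, 2nd ed. (2002), VIII §2 Cor. 8.31.
-/

set_option autoImplicit false
-- the mandated namespace repeats the single-problem summit's segment (`HodgeConjecture.HodgeConjecture`)
set_option linter.dupNamespace false

noncomputable section

open MeasureTheory Measure Filter Topology NumberField NumberField.InfinitePlace NumberField.mixedEmbedding Equiv Function Set
open Literature.MeasureTheory.Group Literature.NumberTheory.Automorphic Literature.NumberTheory.Automorphic.UnitaryGroup
open Literature.LinearAlgebra.Matrix Literature.NumberTheory.Rogawski1990 Literature.NumberTheory.GaloisRepresentations IsDedekindDomain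
open Summit.HodgeConjecture.HodgeConjecture.Cruxes.H413.K2E4ArchGPrimeDefs
open scoped Matrix MatrixGroups Matrix.Norms.Operator ContDiff ENNReal Classical

namespace Summit.HodgeConjecture.HodgeConjecture.Cruxes.H413.K2E4ArchGPrimeData

open Summit.HodgeConjecture.HodgeConjecture.Cruxes.H413.K2E4ExplicitArchSingularTransferDefs (GPrimeData)

section Packer

variable (L : Type) [Field L] [NumberField L] [IsCMField L]

/-- **THE `G′`-PACKAGE EXISTS** (the assembler's `hG`, structure form): under the `hG` binders of ★ `explicitArchSingularTransfer_of_packages` — a diagonal frame `α` (`α_i ≠ 0`,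
`c`-fixed), a transfer factor `T′` on the explicit ray `T′.Δ = c · Δ_expl(μω)` (`c ≠ 0`), a right-invariant Haar `ν` on `U(diag α)_∞`, unit-circle eigenvalues `e₁ ≠ e₂` —
`GPrimeData L α T′ ν e₁ e₂ h₁ h₂` is inhabited: `family` = K2E4-p11's κ-weighted `G′`-state `gState` at the ambient lift of the test function, `reg`∕`step`∕`end_eq` = ★ (reg) ∕ ★ (step) ∕
★ (end). [cite: Rogawski1990, §8.2 Prop. 8.2.1 (a) pp. 118–119; §4.3 (4.3.1) p. 43; §1.7 p. 6] [cite: BorelJacquet1979, §4.1] [cite: Knapp2002, VIII §2 Cor. 8.31] -/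
theorem gPrimeData_nonempty (α : Fin 3 → L) (hα : ∀ i, α i ≠ 0) (hαh : ∀ i, (IsCMField.complexConj L (α i) : L) = α i)
    [MeasurableSpace (UnitaryGroup.arch (↥(maximalRealSubfield L)) L (IsCMField.complexConj L) 3 (Matrix.diagonal α))] [BorelSpace (UnitaryGroup.arch (↥(maximalRealSubfield L)) L (IsCMField.complexConj L) 3 (Matrix.diagonal α))]
    [∀ γ : UnitaryGroup.arch (↥(maximalRealSubfield L)) L (IsCMField.complexConj L) 3 (Matrix.diagonal α), MeasurableSpace (UnitaryGroup.arch (↥(maximalRealSubfield L)) L (IsCMField.complexConj L) 3 (Matrix.diagonal α) ⧸ Subgroup.centralizer ({γ} : Set (UnitaryGroup.arch (↥(maximalRealSubfield L)) L (IsCMField.complexConj L) 3 (Matrix.diagonal α))))]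
    [∀ γ : UnitaryGroup.arch (↥(maximalRealSubfield L)) L (IsCMField.complexConj L) 3 (Matrix.diagonal α), BorelSpace (UnitaryGroup.arch (↥(maximalRealSubfield L)) L (IsCMField.complexConj L) 3 (Matrix.diagonal α) ⧸ Subgroup.centralizer ({γ} : Set (UnitaryGroup.arch (↥(maximalRealSubfield L)) L (IsCMField.complexConj L) 3 (Matrix.diagonal α))))]
    (T' : ArchTransferFactor L (Matrix.diagonal α)) (μω : HeckeCharacter L) (_hμu : μω.IsUnitary)
    (hμω : ∀ x : ideleGroup ↥(maximalRealSubfield L), μω (AdeleRing.ideleBaseChange (↥(maximalRealSubfield L)) L x) = quadraticHeckeCharCM L x)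
    (c : ℂ) (hc : c ≠ 0) (hT' : ∀ a b, T'.Δ a b = c * archExplicitDelta L (Matrix.diagonal α) a μω b)
    (ν : Measure (UnitaryGroup.arch (↥(maximalRealSubfield L)) L (IsCMField.complexConj L) 3 (Matrix.diagonal α))) [ν.IsHaarMeasure] [ν.IsMulRightInvariant]
    (e₁ e₂ : L) (h₁ : (IsCMField.complexConj L e₁ : L) * e₁ = 1) (h₂ : (IsCMField.complexConj L e₂ : L) * e₂ = 1) (hne : e₁ ≠ e₂) :
    Nonempty (GPrimeData L α T' ν e₁ e₂ h₁ h₂) := by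
  classical
  -- the package's σ-algebra convention: per-place groups in the subtype σ-algebra of `borel (GL₃ ℂ)`, wall-centraliser quotients `borel`
  letI iGL : MeasurableSpace (GL (Fin 3) ℂ) := borel _
  haveI : BorelSpace (GL (Fin 3) ℂ) := ⟨rfl⟩
  letI iQ : ∀ (w : {w : InfinitePlace L // IsComplex w}) (τ : Perm (Fin 3)), MeasurableSpace (archLocal L 3 (Matrix.diagonal (α ∘ ⇑τ)) w ⧸ Subgroup.centralizer
      ({(⟨circleDiagonal 3 (wallPoint L e₁ e₂ h₁ h₂ w), circleDiagonal_mem_archLocal_diagonal L 3 (α ∘ ⇑τ) w (wallPoint L e₁ e₂ h₁ h₂ w)⟩ : archLocal L 3 (Matrix.diagonal (α ∘ ⇑τ)) w)} :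
        Set (archLocal L 3 (Matrix.diagonal (α ∘ ⇑τ)) w))) := fun w τ => borel _
  haveI : ∀ (w : {w : InfinitePlace L // IsComplex w}) (τ : Perm (Fin 3)), BorelSpace (archLocal L 3 (Matrix.diagonal (α ∘ ⇑τ)) w ⧸ Subgroup.centralizer
      ({(⟨circleDiagonal 3 (wallPoint L e₁ e₂ h₁ h₂ w), circleDiagonal_mem_archLocal_diagonal L 3 (α ∘ ⇑τ) w (wallPoint L e₁ e₂ h₁ h₂ w)⟩ : archLocal L 3 (Matrix.diagonal (α ∘ ⇑τ)) w)} :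
        Set (archLocal L 3 (Matrix.diagonal (α ∘ ⇑τ)) w))) := fun w τ => ⟨rfl⟩
  -- the given Haar `ν` read as a product of per-place Haar measures (`χ = 1`), each right-invariant (unimodularity)
  obtain ⟨νw, hνwH, hνpi⟩ := exists_isHaarMeasure_eq_map_archPiEquivCM_symm_pi L 3 α ν
  have hνw : ∀ v : {w : InfinitePlace L // IsComplex w}, (νw v).IsHaarMeasure ∧ (νw v).IsMulRightInvariant := fun v =>
    ⟨hνwH v, by haveI := hνwH v; exact isMulRightInvariant_of_isHaarMeasure_archLocal_diagonal L α hα hαh v (νw v)⟩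
  have hν : ν = (1 : ℝ≥0∞) • (Measure.pi νw).map (archPiEquivCM 3 L (Matrix.diagonal α)).symm := by
    rw [one_smul]; exact hνpi
  -- the pinned wall references (★ (pins)) and the end state (★ (end))
  obtain ⟨νH, hνH, hpin⟩ := K2E4ArchGPrimePins.exists_pinnedRefs L α hα hαh e₁ e₂ h₁ h₂ hne
  obtain ⟨lam, hlam, hend⟩ := K2E4ArchGPrimeEnd.exists_gState_univ_eq L α hα hαh νw hνw e₁ e₂ h₁ h₂ hne νH hνH hpin ν 1 one_ne_zero ENNReal.one_ne_top hν
    T' μω hμω c hc hT'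
  -- the ambient `C_c^∞` lift of a test function
  have hΘ : ∀ (b : UnitaryGroup.arch (↥(maximalRealSubfield L)) L (IsCMField.complexConj L) 3 (Matrix.diagonal α) → ℂ) (hb : ArchSmooth L 3 (Matrix.diagonal α) b),
      ContDiff ℝ ∞ (Classical.choose (ArchSmooth.exists_contDiff hb)) ∧
      HasCompactSupport (fun g : UnitaryGroup.arch (↥(maximalRealSubfield L)) L (IsCMField.complexConj L) 3 (Matrix.diagonal α) => Classical.choose (ArchSmooth.exists_contDiff hb) ((g : GL (Fin 3) (mixedSpace L)) : Matrix (Fin 3) (Fin 3) (mixedSpace L))) ∧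
      ∀ k : UnitaryGroup.arch (↥(maximalRealSubfield L)) L (IsCMField.complexConj L) 3 (Matrix.diagonal α), b k = Classical.choose (ArchSmooth.exists_contDiff hb) ((k : GL (Fin 3) (mixedSpace L)) : Matrix (Fin 3) (Fin 3) (mixedSpace L)) :=
    fun b hb => ⟨(Classical.choose_spec (ArchSmooth.exists_contDiff hb)).1, (Classical.choose_spec (ArchSmooth.exists_contDiff hb)).2.2.1,
      (Classical.choose_spec (ArchSmooth.exists_contDiff hb)).2.2.2⟩
  refine ⟨
    { lam := lam
      lam_ne_zero := hlam
      family := fun b hb S u => gState L α νw hνw e₁ e₂ h₁ h₂ hne νH hνH T' 1 (Classical.choose (ArchSmooth.exists_contDiff hb)) S u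
      reg := fun b hb u hu => ?_
      step := fun b hb S w hw u hu => ?_
      end_eq := fun b hb u => ?_ }⟩
  · -- (reg) ★ `gState_empty_eq_finsum`
    exact K2E4ArchGPrimeReg.gState_empty_eq_finsum L α hα hαh νw hνw e₁ e₂ h₁ h₂ hne νH hνH ν 1 hν T' _ (hΘ b hb).1.continuous b (hΘ b hb).2.2 u hu
  · -- (step) ★ `gState_step`
    exact K2E4ArchGPrimeStep.gState_step L α hα hαh νw hνw e₁ e₂ h₁ h₂ hne νH hνH hpin T' μω hμω c hc hT' 1 _ (hΘ b hb).1 (hΘ b hb).2.1 S w hw u hu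
  · -- (end) ★ `exists_gState_univ_eq`, read through `b = Θ_b ∘ (↑↑·)`
    have e : (fun g : UnitaryGroup.arch (↥(maximalRealSubfield L)) L (IsCMField.complexConj L) 3 (Matrix.diagonal α) => Classical.choose (ArchSmooth.exists_contDiff hb) ((g : GL (Fin 3) (mixedSpace L)) : Matrix (Fin 3) (Fin 3) (mixedSpace L))) = b :=
      (funext (hΘ b hb).2.2).symm
    have h := hend _ (hΘ b hb).1.continuous (hΘ b hb).2.1 u
    rw [e] at h
    exact h

end Packer

end Summit.HodgeConjecture.HodgeConjecture.Cruxes.H413.K2E4ArchGPrimeData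

end
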